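import Summits.AtomisticToContinuum.HydrodynamicLimit.Theorems.OneFlightGossipEngineClampedTransferDockOfInputs
import Summits.AtomisticToContinuum.HydrodynamicLimit.Theorems.OneFlightGossipEngineClampedTransferDockSeet
import HarnessLib

/-!
# The signed band remainder — statements of the reshaped line `IdeatorOneSketch` (v16) of the crux `HydroLimitInBand`
# (stmt-AtomisticToContinuum-9133; support file, `--supports` it)

The registered stub `stub_itemizedInputs` of skeleton v15 (`Cruxes/HydroLimitInBand/Lines/IdeatorOneSketch.lean`) bundled six route
items of OneFlightGossipEngine; one of them, `BandCoherenceLDAlongFamilies` (BCL, stmt-17700), is refuted by the Galilean-boost witness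
(refuter rattack-17700-0; helpers `Theorems/BandCoherenceLDAlongFamilies/Negative/*`): the band-coherence functional has non-zero linear
response to a conserved mode (a boost of the flow-invariant homogeneous reference law costs `(N+1)D²/2θ` of entropy, quadratic, and raises
the functional linearly), so no fixed-tilt scale-`N` exponential bound can hold. Skeleton v16 re-threads the landed rate dock
`ClampedTransferDockSketch.clampedTransferDock_of_inputs` (p140743) around BCL by the repair R1 of crux-ideate 17700 k2
(`Cruxes/BandCoherenceLDAlongFamilies/IdeatorTwoBoostWitnessAndRepair.md` §6): the suprathermal heat-flux remainder
`hi = (b·w)(|w|² − 5θ − G(x,|w|²))` of the rate cubic channel is paid SIGNED — its band part as the Nachtergaele–Yau truncation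
re-orthogonalised to the collision invariants, a member of the kinetic-currents class of growth `C_B K₁`, by the two-sided entropy
inequality at the tilt `β₀/(C_B K₁)`; this needs the kinetic window LD with a tilt threshold UNIFORM over the normalised class (KCWF-Q).
This file DECLARES the five statements of v16 (registered stub signatures of the line, route-internal, not cited facts), so that the
lead's and the workers' proof files share one copy, and proves the registered sub-goal `kcwf_of_kcwfQ` (KCWF-Q ⟹ KCWF):

* `KineticCurrentsLDAlongFamiliesQ` — KCWF-Q, the new conjecture-grade input (crux-ideate 17700 k2's text verbatim); implies
  `OneFlightGossipEngine.KineticCurrentsLDAlongFamilies` (stmt-16659);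
* `BandShiftStatics` — the re-orthogonalised band truncation (static Gaussian analysis; provable);
* `KineticInstanceOrth` — KC1 (`ClampedCurrentsDockKineticInstance.KineticInstance`) with the momentum-orthogonality of its cut-off
  exported (provable);
* `CubicChannelRateS` — the signed rate cubic channel (same conclusion as `ClampedTransferDockCubicRate.CubicChannelRate`, band input
  KCWF-Q instead of BCL, extra hypothesis `(b·w)G ⊥ v_k`; provable from its antecedents);
* `WindowClauseRateS` — the D-shape one-window ledger over the signed channel (conclusion byte-identical with
  `ClampedTransferDockRate.WindowClauseRate`, so the landed `ClampedTransferDockLedgerEndD.stub_ledgerEndD` applies; provable plumbing).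

References: H.-T. Yau, Lett. Math. Phys. 22 (1991) §2; B. Nachtergaele, H.-T. Yau, Comm. Math. Phys. 243 (2003) §5, §7 (momentum
truncation of the energy current at tilt `δ/M`). prover-line-stmt-AtomisticToContinuum-9133-c17-0 (lead, line cycle 18).
-/

noncomputable section

open MeasureTheory Filter Set Topology InformationTheory
open scoped ENNReal

namespace Summit.AtomisticToContinuum.HydrodynamicLimit.Theorems.HydroLimitInBandSignedBand

open Literature.MathematicalPhysics.KineticTheory Literature.Analysis.FluidPDE Literature.Analysis.FunctionSpaces
open Summit.AtomisticToContinuum.HydrodynamicLimit.Theses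
open Summit.AtomisticToContinuum.HydrodynamicLimit.Theorems

/-- registered stub signature `stub_kcwfQ` of line IdeatorOneSketch, crux HydroLimitInBand (stmt-AtomisticToContinuum-9133) — route-internal, not a cited fact.
**KCWF-Q — the kinetic-currents window LD along families with a CLASS-UNIFORM tilt threshold** (repair R1 of the refuted
BandCoherenceLDAlongFamilies, crux-ideate 17700 k2 `IdeatorTwo.KineticCurrentsLDAlongFamiliesQ`, verbatim): differs from
`OneFlightGossipEngine.KineticCurrentsLDAlongFamilies` (stmt-16659) only in the position of `∃ β₀` (before the weights `A, b, G`) and the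
normalisation `|β| * C ≤ β₀`; implies it (`kcwf_of_kcwfQ`). New conjecture-grade INPUT of the line (to be promoted to an item). -/
def KineticCurrentsLDAlongFamiliesQ : Prop :=
  ∃ η₀ : ℝ, 0 < η₀ ∧ ∀ (t₁ : ℝ) (a θ₀ : ℝ → T3 → ℝ) (u₀ : ℝ → T3 → V3),
    Continuous (Function.uncurry a) → Continuous (Function.uncurry θ₀) → Continuous (Function.uncurry u₀) →
    (∀ s x, 0 < a s x) → (∀ s x, 0 < θ₀ s x) → ∀ σ : ℝ, 0 < σ →
    (∀ s ∈ Set.Icc 0 t₁, σ ^ 3 * (⨆ x, a s x) ≤ η₀ * ∫ x, a s x) →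
    ∀ Φ : (N : ℕ) → HardSphereFlow (Torus.geometry (Fin 3)) (hsDiameter σ N) (N + 1),
    ∃ β₀ : ℝ, 0 < β₀ ∧
    ∀ (A : ℝ → T3 → Fin 3 → Fin 3 → ℝ) (b : ℝ → T3 → V3) (G : ℝ → T3 × ℝ → ℝ),
    Continuous (Function.uncurry A) → Continuous (Function.uncurry b) → Continuous (Function.uncurry G) →
    (let F := fun (s : ℝ) (y : T3 × V3) =>
        (∑ j : Fin 3, ∑ k : Fin 3, A s y.1 j k * ((y.2 - u₀ s y.1) j * (y.2 - u₀ s y.1) k)) +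
          (∑ j : Fin 3, b s y.1 j * (y.2 - u₀ s y.1) j) * G s (y.1, ‖y.2 - u₀ s y.1‖ ^ 2)
     ∀ C : ℝ, 0 < C → (∀ s ∈ Set.Icc 0 t₁, ∀ y : T3 × V3, |F s y| ≤ C * (1 + ‖y.2‖ ^ 2)) →
     (∀ s ∈ Set.Icc 0 t₁, ∀ x, ∫ v, F s (x, v) * localMaxwellian 1 (θ₀ s x) (u₀ s x) v = 0) →
     (∀ s ∈ Set.Icc 0 t₁, ∀ x (j : Fin 3), ∫ v, F s (x, v) * v j * localMaxwellian 1 (θ₀ s x) (u₀ s x) v = 0) →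
     (∀ s ∈ Set.Icc 0 t₁, ∀ x, ∫ v, F s (x, v) * ‖v‖ ^ 2 * localMaxwellian 1 (θ₀ s x) (u₀ s x) v = 0) →
     ∀ β : ℝ, |β| * C ≤ β₀ → ∀ ε : ℝ, 0 < ε → ∃ τ₀ : ℝ, 0 < τ₀ ∧ ∀ τ : ℝ, τ₀ ≤ τ →
     ∃ N₀ : ℕ, ∀ N : ℕ, N₀ ≤ N → ∀ s ∈ Set.Icc 0 t₁,
       ∫⁻ z, ENNReal.ofReal (Real.exp (β * ∑ i : Fin (N + 1),
           (τ * ((N : ℝ) + 1) ^ (-(1 / 3 : ℝ)))⁻¹ *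
             ∫ r in (0 : ℝ)..(τ * ((N : ℝ) + 1) ^ (-(1 / 3 : ℝ))), F s ((Φ N).flow r z i)))
         ∂(localGibbsLaw σ (a s) (u₀ s) (θ₀ s) N (Φ N)) ≤ ENNReal.ofReal (Real.exp (ε * ((N : ℝ) + 1))))

/-- registered stub signature `stub_bandShiftStatics` of line IdeatorOneSketch, crux HydroLimitInBand (stmt-AtomisticToContinuum-9133) — route-internal, not a cited fact.
**BandShiftStatics — the re-orthogonalised band truncation of the suprathermal heat-flux remainder** (static Gaussian analysis,
provable): for globally continuous families `θ ∈ [θm, θM]`, `‖u‖ ≤ U`, `‖b‖ ≤ Bb` and a bounded continuous cut-off profile `G` agreeing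
with `s′ − 5θ` below `1` with `(b·w)G ⊥ v_k` under the local Maxwellian, and every rate `c`, there are `A, K₀` such that for every level
`K₁ ≥ K₀` the remainder `hi = (b·w)(|w|² − 5θ − G(x,|w|²))` splits as a BOUNDED odd class member `F_b = (b·w) G_b(x,|w|²)` (`G_b` jointly
continuous) of growth `≤ C_B K₁ (1+|v|²)` (`C_B` independent of `K₁`), orthogonal to `1, v_k, |v|²`, plus a remainder bounded by the
cubic top tail `Bb C_R 1{K₁ < |w|}|w|³` and the super-exponentially small constant `A e^{-cK₁}` (construction: `G_b = Rχ_{K₁²} − ρ ω₀(·/θ)`,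
`ρ` chosen to restore the radial moment; the correction is a Gaussian tail because `(b·w)R ⊥ v_k`, Wick `E ξ₀²|ξ|² = 5`). -/
def BandShiftStatics : Prop :=
  ∀ (θ : ℝ → T3 → ℝ) (u b : ℝ → T3 → V3) (G : ℝ → T3 × ℝ → ℝ) (θm θM U Bb C_G : ℝ),
    0 < θm → θm ≤ θM → 0 ≤ U → 0 ≤ Bb → 0 ≤ C_G →
    Continuous (Function.uncurry θ) → Continuous (Function.uncurry u) → Continuous (Function.uncurry b) →
    Continuous (Function.uncurry G) →
    (∀ s x, θm ≤ θ s x) → (∀ s x, θ s x ≤ θM) → (∀ s x, ‖u s x‖ ≤ U) → (∀ s x, ‖b s x‖ ≤ Bb) →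
    (∀ (s : ℝ) (y : T3 × ℝ), 0 ≤ y.2 → |G s y| ≤ C_G) →
    (∀ (s : ℝ) (x : T3) (s' : ℝ), s' ≤ 1 → G s (x, s') = s' - 5 * θ s x) →
    (∀ (s : ℝ) (x : T3) (k : Fin 3),
      ∫ v, ((∑ j : Fin 3, b s x j * (v - u s x) j) * G s (x, ‖v - u s x‖ ^ 2)) * v k *
        localMaxwellian 1 (θ s x) (u s x) v = 0) →
    ∃ CB : ℝ, 1 ≤ CB ∧ ∀ c : ℝ, 0 < c → ∃ A : ℝ, 0 ≤ A ∧ ∃ K₀ : ℝ, 1 ≤ K₀ ∧ ∀ K₁ : ℝ, K₀ ≤ K₁ →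
      ∃ Gb : ℝ → T3 × ℝ → ℝ, Continuous (Function.uncurry Gb) ∧
        (∃ M : ℝ, ∀ (s : ℝ) (y : T3 × V3),
          |(∑ j : Fin 3, b s y.1 j * (y.2 - u s y.1) j) * Gb s (y.1, ‖y.2 - u s y.1‖ ^ 2)| ≤ M) ∧
        (∀ (s : ℝ) (y : T3 × V3),
          |(∑ j : Fin 3, b s y.1 j * (y.2 - u s y.1) j) * Gb s (y.1, ‖y.2 - u s y.1‖ ^ 2)| ≤
            CB * K₁ * (1 + ‖y.2‖ ^ 2)) ∧
        (∀ (s : ℝ) (x : T3), ∫ v, ((∑ j : Fin 3, b s x j * (v - u s x) j) * Gb s (x, ‖v - u s x‖ ^ 2)) *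
          localMaxwellian 1 (θ s x) (u s x) v = 0) ∧
        (∀ (s : ℝ) (x : T3) (k : Fin 3),
          ∫ v, ((∑ j : Fin 3, b s x j * (v - u s x) j) * Gb s (x, ‖v - u s x‖ ^ 2)) * v k *
            localMaxwellian 1 (θ s x) (u s x) v = 0) ∧
        (∀ (s : ℝ) (x : T3), ∫ v, ((∑ j : Fin 3, b s x j * (v - u s x) j) * Gb s (x, ‖v - u s x‖ ^ 2)) * ‖v‖ ^ 2 *
          localMaxwellian 1 (θ s x) (u s x) v = 0) ∧
        (∀ (s : ℝ) (y : T3 × V3),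
          |(∑ j : Fin 3, b s y.1 j * (y.2 - u s y.1) j) *
                (‖y.2 - u s y.1‖ ^ 2 - 5 * θ s y.1 - G s (y.1, ‖y.2 - u s y.1‖ ^ 2)) -
              (∑ j : Fin 3, b s y.1 j * (y.2 - u s y.1) j) * Gb s (y.1, ‖y.2 - u s y.1‖ ^ 2)| ≤
            Bb * (1 + 5 * θM + C_G) * (if K₁ < ‖y.2 - u s y.1‖ then ‖y.2 - u s y.1‖ ^ 3 else 0) +
              A * Real.exp (-(c * K₁)))

/-- registered stub signature `stub_kineticInstanceOrth` of line IdeatorOneSketch, crux HydroLimitInBand (stmt-AtomisticToContinuum-9133) — route-internal, not a cited fact.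
**KineticInstanceOrth — KC1 with the orthogonality of the cut-off exported** (provable: the landed
`ClampedCurrentsDockKineticInstance.stub_kineticInstance` re-proved keeping the momentum row of S11F for the heat-flux coefficient
`∇θ/(2θ²)` on the slab). -/
def KineticInstanceOrth : Prop :=
  ClampedCurrentsDockKineticInstance.KineticCurrentsWindowLDFamily →
    ClampedCurrentsDockKineticInstance.LoHeatFluxCutoffFamily →
  ∃ ηK : ℝ, 0 < ηK ∧ ∀ (t₁ : ℝ) (a θ : ℝ → T3 → ℝ) (u : ℝ → T3 → V3), 0 ≤ t₁ →
    ContinuousOn (Function.uncurry a) (Set.Icc 0 t₁ ×ˢ Set.univ) → (∀ s ∈ Set.Icc 0 t₁, ∀ x, 0 < a s x) →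
    Torus.IsSmoothSpaceTimeOn (Set.Icc 0 t₁) θ → Torus.IsSmoothSpaceTimeOn (Set.Icc 0 t₁) u →
    (∀ s ∈ Set.Icc 0 t₁, ∀ x, 0 < θ s x) →
    ∀ σ : ℝ, 0 < σ → (∀ s ∈ Set.Icc 0 t₁, σ ^ 3 * (⨆ x, a s x) ≤ ηK * ∫ x, a s x) →
    ∀ Φ : (N : ℕ) → HardSphereFlow (Torus.geometry (Fin 3)) (hsDiameter σ N) (N + 1),
    ∀ Kstar : ℝ, 0 < Kstar →
    ∃ G : ℝ → T3 × ℝ → ℝ, ContinuousOn (Function.uncurry G) (Set.Icc 0 t₁ ×ˢ Set.univ) ∧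
      (∃ C : ℝ, ∀ s ∈ Set.Icc 0 t₁, ∀ y : T3 × ℝ, 0 ≤ y.2 → |G s y| ≤ C) ∧
      (∀ s ∈ Set.Icc 0 t₁, ∀ (x : T3) (s' : ℝ), s' ≤ Kstar ^ 2 → G s (x, s') = s' - 5 * θ s x) ∧
      (∀ s ∈ Set.Icc 0 t₁, ∀ (x : T3) (k : Fin 3),
        ∫ v, ((∑ j : Fin 3, Torus.partialDeriv j (θ s) x / (2 * (θ s x) ^ 2) * (v - u s x) j) *
            G s (x, ‖v - u s x‖ ^ 2)) * v k * localMaxwellian 1 (θ s x) (u s x) v = 0) ∧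
      ∃ β₀ : ℝ, 0 < β₀ ∧ ∀ β : ℝ, |β| ≤ β₀ → ∀ ε : ℝ, 0 < ε → ∃ τ₀ : ℝ, 0 < τ₀ ∧ ∀ τ : ℝ, τ₀ ≤ τ →
      ∃ N₀ : ℕ, ∀ N : ℕ, N₀ ≤ N → ∀ s ∈ Set.Icc 0 t₁,
        (let lo := fun (s : ℝ) (y : T3 × V3) =>
           (θ s y.1)⁻¹ * ∑ j : Fin 3, ∑ k : Fin 3,
               ((y.2 - u s y.1) j * (y.2 - u s y.1) k - (if j = k then ‖y.2 - u s y.1‖ ^ 2 / 3 else 0)) *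
                 Torus.partialDeriv k (fun x => u s x j) y.1 +
             (∑ k : Fin 3, Torus.partialDeriv k (θ s) y.1 / (2 * (θ s y.1) ^ 2) * (y.2 - u s y.1) k) *
               G s (y.1, ‖y.2 - u s y.1‖ ^ 2)
         ∫⁻ z, ENNReal.ofReal (Real.exp (β * ∑ i : Fin (N + 1),
             (τ * ((N : ℝ) + 1) ^ (-(1 / 3 : ℝ)))⁻¹ *
               ∫ r in (0 : ℝ)..(τ * ((N : ℝ) + 1) ^ (-(1 / 3 : ℝ))), lo s ((Φ N).flow r z i)))
           ∂(localGibbsLaw σ (a s) (u s) (θ s) N (Φ N)) ≤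
         ENNReal.ofReal (Real.exp (ε * ((N : ℝ) + 1))))

/-- registered stub signature `stub_cubicChannelRateS` of line IdeatorOneSketch, crux HydroLimitInBand (stmt-AtomisticToContinuum-9133) — route-internal, not a cited fact.
**CubicChannelRateS — the SIGNED rate cubic channel** (replaces `ClampedTransferDockCubicRate.CubicChannelRate`, whose band input BCL is
refuted): the suprathermal heat-flux remainder of one window in expectation under the true law, band part paid SIGNED by the two-sided
entropy inequality w.r.t. `ψ_s` at the tilt `β₀/(C_B K₁)` fed with KCWF-Q along the clamped reference family (member `(b·w)G_b` of
BandShiftStatics), top `|w| > K₁` and all cubic tails by SEET; extra hypothesis: `(b·w)G ⊥ v_k` for the given cut-off; SAME conclusion. -/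
def CubicChannelRateS : Prop :=
  BandShiftStatics → ClampedCurrentsDockCubicChannel.WindowFlowShift → KineticCurrentsLDAlongFamiliesQ →
  OneFlightGossipEngine.SuperExponentialEnergyTails →
  ∀ (r : ℝ) (Rf : ℝ → ℝ), 0 < r → (∀ x ∈ Set.Icc 0 r, 1 ≤ Rf x ∧ Rf x ≤ 2) → ContinuousOn Rf (Set.Icc 0 r) →
  ∃ ηQ : ℝ, 0 < ηQ ∧
  ∀ (a₀ θ₀ : T3 → ℝ) (u₀ : T3 → V3), Continuous a₀ → Continuous θ₀ → Continuous u₀ →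
    (∀ x, 0 < a₀ x) → (∀ x, 0 < θ₀ x) →
    ∃ σ₀ : ℝ, 0 < σ₀ ∧ ∀ σ : ℝ, 0 < σ → σ < σ₀ →
    ∀ (T : ℝ) (ρ θ : ℝ → T3 → ℝ) (u : ℝ → T3 → V3), IsHardSphereEulerSolution σ T ρ u θ →
    (∀ s ∈ Set.Ico 0 T, ∀ x, ρ s x * σ ^ 3 < ηQ) →
    ∀ Φ : (N : ℕ) → HardSphereFlow (Torus.geometry (Fin 3)) (hsDiameter σ N) (N + 1),
    TendstoHydroFieldsAt (fun N => localGibbsLaw σ a₀ u₀ θ₀ N (Φ N)) Φ ρ u θ 0 →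
    ∀ t ∈ Set.Ico 0 T, ∃ Kstar : ℝ, 0 < Kstar ∧
    ∀ (G : ℝ → T3 × ℝ → ℝ) (C_G : ℝ), 0 ≤ C_G → ContinuousOn (Function.uncurry G) (Set.Icc 0 t ×ˢ Set.univ) →
    (∀ s ∈ Set.Icc 0 t, ∀ y : T3 × ℝ, 0 ≤ y.2 → |G s y| ≤ C_G) →
    (∀ s ∈ Set.Icc 0 t, ∀ (x : T3) (s' : ℝ), s' ≤ Kstar ^ 2 → G s (x, s') = s' - 5 * θ s x) →
    (∀ s ∈ Set.Icc 0 t, ∀ (x : T3) (k : Fin 3),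
      ∫ v, ((∑ j : Fin 3, Torus.partialDeriv j (θ s) x / (2 * (θ s x) ^ 2) * (v - u s x) j) *
          G s (x, ‖v - u s x‖ ^ 2)) * v k * localMaxwellian 1 (θ s x) (u s x) v = 0) →
    ∃ B : ℝ, 0 ≤ B ∧ ∀ c : ℝ, 0 < c → ∃ A : ℝ, 0 ≤ A ∧ ∃ K₀ : ℝ, 0 < K₀ ∧ ∀ K₁ : ℝ, K₀ ≤ K₁ →
    ∀ ε : ℝ, 0 < ε → ∃ τ₀ : ℝ, 0 < τ₀ ∧ ∀ τ : ℝ, τ₀ ≤ τ → ∃ N₀ : ℕ, ∀ N : ℕ, N₀ ≤ N →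
    ∀ s : ℝ, 0 ≤ s → s + τ * ((N : ℝ) + 1) ^ (-(1 / 3 : ℝ)) ≤ t →
      (let w : ℝ := τ * ((N : ℝ) + 1) ^ (-(1 / 3 : ℝ))
       let hi := fun (s : ℝ) (y : T3 × V3) =>
         (∑ k : Fin 3, Torus.partialDeriv k (θ s) y.1 / (2 * (θ s y.1) ^ 2) * (y.2 - u s y.1) k) *
           (‖y.2 - u s y.1‖ ^ 2 - 5 * θ s y.1 - G s (y.1, ‖y.2 - u s y.1‖ ^ 2))
       ∫⁻ z, ENNReal.ofReal |∫ r in s..(s + w), ∑ i : Fin (N + 1), hi s ((Φ N).flow r z i)|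
           ∂(localGibbsLaw σ a₀ u₀ θ₀ N (Φ N)) ≤
         ENNReal.ofReal (w * ((N : ℝ) + 1) * (ε + A * Real.exp (-(c * K₁))) +
           w * (B * K₁) * (klDiv ((Φ N).lawAt (localGibbsLaw σ a₀ u₀ θ₀ N (Φ N)) s)
             (localGibbsLaw σ (fun x => ρ s x * Rf (σ ^ 3 * ρ s x)) (u s) (θ s) N (Φ N))).toReal))

/-- registered stub signature `stub_windowClauseRateS` of line IdeatorOneSketch, crux HydroLimitInBand (stmt-AtomisticToContinuum-9133) — route-internal, not a cited fact.
**WindowClauseRateS — the one-window ledger at a rate, D-shape, over the signed cubic channel** (provable plumbing: the landed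
`ClampedTransferDockRate.stub_windowClauseRate` re-plumbed with `CubicChannelRateS`/`BandShiftStatics`/`KineticInstanceOrth`/KCWF-Q in
place of `CubicChannelRate`/BCL; conclusion byte-identical, so the landed `ClampedTransferDockLedgerEndD.stub_ledgerEndD` applies). -/
def WindowClauseRateS : Prop :=
  ClampedTransferDockRate.WindowEstimateRate → CubicChannelRateS → BandShiftStatics → KineticInstanceOrth →
    KineticCurrentsLDAlongFamiliesQ → OneFlightGossipEngine.SuperExponentialEnergyTails →
    HydroLimitInBandOfHeart.LocalClampedTransferWindowLDFamily → HydroLimitInBandOfHeart.CollisionEnergyActivityTails →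
    HydroLimitInBandOfHeart.KineticCurrentsWindowLDFamily →
    OneFlightGossipEngine.CollisionActivityTails → OneFlightGossipEngine.EnergyCurrentTails →
  ∀ (r : ℝ) (Rf : ℝ → ℝ), 0 < r →
    (∃ p : FormalMultilinearSeries ℝ ℝ ℝ, HasFPowerSeriesOnBall Rf p 0 (ENNReal.ofReal r)) →
    (∃ L : NNReal, LipschitzOnWith L Rf (Icc 0 r)) →
    (∀ x ∈ Ioo (-r) r, 0 < Rf x ∧ Rf x * (∑' j : ℕ, bE j / (j.factorial : ℝ) * (x * Rf x) ^ j) = 1) →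
    (∀ x ∈ Icc 0 r, 1 ≤ Rf x ∧ Rf x ≤ 2) → ContinuousOn Rf (Icc 0 r) →
    (∀ x ∈ Ioo (-r) r, ∀ R ∈ Icc (1 / 2 : ℝ) 2,
      R * (∑' j : ℕ, bE j / (j.factorial : ℝ) * (x * R) ^ j) = 1 → R = Rf x) →
    ∀ η₀ : ℝ, 0 < η₀ →
    (∀ (a θ₀ : T3 → ℝ) (u₀ : T3 → V3), Continuous a → Continuous θ₀ → Continuous u₀ → (∀ x, 0 < a x) →
      (∀ x, 0 < θ₀ x) → ∀ σ : ℝ, 0 < σ → σ ^ 3 * (⨆ x, a x) ≤ η₀ * ∫ x, a x →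
      ∃ ρ₀ : T3 → ℝ, Continuous ρ₀ ∧ (∀ x, 0 < ρ₀ x) ∧
        (∀ (N : ℕ) (Φ : HardSphereFlow (Torus.geometry (Fin 3)) (hsDiameter σ N) (N + 1)),
          IsProbabilityMeasure (localGibbsLaw σ a u₀ θ₀ N Φ)) ∧
        ∀ χ : T3 → ℝ, Continuous χ → ∀ δ : ℝ, 0 < δ → ∃ C : ℝ, 0 < C ∧
          ∀ (N : ℕ) (Φ : HardSphereFlow (Torus.geometry (Fin 3)) (hsDiameter σ N) (N + 1)),
            localGibbsLaw σ a u₀ θ₀ N Φ {z | δ < |empiricalDensityField z χ - ∫ x, χ x * ρ₀ x|} ≤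
                ENNReal.ofReal (C * Real.exp (-(C⁻¹ * ((N : ℝ) + 1)))) ∧
              localGibbsLaw σ a u₀ θ₀ N Φ
                  {z | δ < ‖empiricalMomentumField z χ - ∫ x, (χ x * ρ₀ x) • u₀ x‖} ≤
                ENNReal.ofReal (C * Real.exp (-(C⁻¹ * ((N : ℝ) + 1)))) ∧
              localGibbsLaw σ a u₀ θ₀ N Φ {z | δ < |empiricalEnergyField z χ -
                  ∫ x, χ x * totalEnergyDensity (ρ₀ x) (u₀ x) (θ₀ x)|} ≤
                ENNReal.ofReal (C * Real.exp (-(C⁻¹ * ((N : ℝ) + 1))))) →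
    ∃ ηp : ℝ, 0 < ηp ∧
    ∀ (a₀ θ₀ : T3 → ℝ) (u₀ : T3 → V3), Continuous a₀ → Continuous θ₀ → Continuous u₀ →
      (∀ x, 0 < a₀ x) → (∀ x, 0 < θ₀ x) →
      ∃ σ₀ : ℝ, 0 < σ₀ ∧ ∀ σ : ℝ, 0 < σ → σ < σ₀ →
        ∀ (T : ℝ) (ρ θ : ℝ → T3 → ℝ) (u : ℝ → T3 → V3), IsHardSphereEulerSolution σ T ρ u θ →
          (∀ s ∈ Set.Ico 0 T, ∀ x, ρ s x * σ ^ 3 < ηp) →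
          ∀ Φ : (N : ℕ) → HardSphereFlow (Torus.geometry (Fin 3)) (hsDiameter σ N) (N + 1),
            TendstoHydroFieldsAt (fun N => localGibbsLaw σ a₀ u₀ θ₀ N (Φ N)) Φ ρ u θ 0 →
            ∀ t ∈ Set.Ioo 0 T,
              ∃ Cst : ℝ → ℝ, ContinuousOn Cst (Set.Icc 0 t) ∧
                (∀ ε : ℝ, 0 < ε → ∃ N₀ : ℕ, ∀ N : ℕ, N₀ ≤ N → ∀ t' ∈ Set.Icc 0 t,
                  |Real.log (posPartition (fun x => ρ t' x * Rf (σ ^ 3 * ρ t' x)) (hsDiameter σ N) (N + 1)) -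
                      Real.log (posPartition (fun x => ρ 0 x * Rf (σ ^ 3 * ρ 0 x)) (hsDiameter σ N) (N + 1)) +
                    ((N : ℝ) + 1) * ∫ r in (0 : ℝ)..t', Cst r| ≤ ((N : ℝ) + 1) * ε) ∧
                ∀ δ : ℝ, 0 < δ → ∃ K : ℝ, 0 ≤ K ∧ ∃ ε : ℝ, 0 < ε ∧ 4 * (1 + t) * ε * Real.exp (2 * K * t) ≤ δ ∧
                ∃ τ : ℝ, 0 < τ ∧ ∃ N₀ : ℕ, ∀ N : ℕ, N₀ ≤ N →
                ∀ s : ℝ, 0 ≤ s → s + τ * ((N : ℝ) + 1) ^ (-(1 / 3 : ℝ)) ≤ t →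
                (klDiv ((Φ N).lawAt (localGibbsLaw σ a₀ u₀ θ₀ N (Φ N)) (s + τ * ((N : ℝ) + 1) ^ (-(1 / 3 : ℝ))))
                  (localGibbsLaw σ (fun x => ρ (s + τ * ((N : ℝ) + 1) ^ (-(1 / 3 : ℝ))) x *
                      Rf (σ ^ 3 * ρ (s + τ * ((N : ℝ) + 1) ^ (-(1 / 3 : ℝ))) x))
                    (u (s + τ * ((N : ℝ) + 1) ^ (-(1 / 3 : ℝ)))) (θ (s + τ * ((N : ℝ) + 1) ^ (-(1 / 3 : ℝ))))
                    N (Φ N))).toReal ≤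
                (klDiv ((Φ N).lawAt (localGibbsLaw σ a₀ u₀ θ₀ N (Φ N)) s)
                  (localGibbsLaw σ (fun x => ρ s x * Rf (σ ^ 3 * ρ s x)) (u s) (θ s) N (Φ N))).toReal +
                K * (τ * ((N : ℝ) + 1) ^ (-(1 / 3 : ℝ))) *
                  sSup ((fun s' => (klDiv ((Φ N).lawAt (localGibbsLaw σ a₀ u₀ θ₀ N (Φ N)) s')
                    (localGibbsLaw σ (fun x => ρ s' x * Rf (σ ^ 3 * ρ s' x)) (u s') (θ s') N (Φ N))).toReal) ''
                    Set.Icc 0 (s + τ * ((N : ℝ) + 1) ^ (-(1 / 3 : ℝ)))) +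
                (τ * ((N : ℝ) + 1) ^ (-(1 / 3 : ℝ))) * ((N : ℝ) + 1) * ε +
                ((Real.log (posPartition (fun x => ρ (s + τ * ((N : ℝ) + 1) ^ (-(1 / 3 : ℝ))) x *
                      Rf (σ ^ 3 * ρ (s + τ * ((N : ℝ) + 1) ^ (-(1 / 3 : ℝ))) x)) (hsDiameter σ N) (N + 1)) -
                    Real.log (posPartition (fun x => ρ s x * Rf (σ ^ 3 * ρ s x)) (hsDiameter σ N) (N + 1))) +
                  (τ * ((N : ℝ) + 1) ^ (-(1 / 3 : ℝ))) * ((N : ℝ) + 1) * Cst s)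

/-- registered sub-goal `kcwf_of_kcwfQ` of line IdeatorOneSketch, crux HydroLimitInBand (stmt-AtomisticToContinuum-9133).
**KCWF-Q implies KCWF** (the heart's family typing `HydroLimitInBandOfHeart.KineticCurrentsWindowLDFamily`, = stmt-16659 as a term):
given the growth constant `C` of a member, the class-uniform threshold `β₀` gives the member threshold `β₀ / max C 1`. [folklore] -/
theorem kcwf_of_kcwfQ : KineticCurrentsLDAlongFamiliesQ → HydroLimitInBandOfHeart.KineticCurrentsWindowLDFamily := by
  rintro ⟨η₀, hη₀, H⟩
  refine ⟨η₀, hη₀, fun t₁ a θ₀ u₀ hac hθc huc ha0 hθ0 σ hσ hguard Φ A b G hA hb hG => ?_⟩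
  obtain ⟨β₀, hβ₀, Hβ⟩ := H t₁ a θ₀ u₀ hac hθc huc ha0 hθ0 σ hσ hguard Φ
  intro F hC h0 h1 h2
  obtain ⟨C, hC⟩ := hC
  have hm : 0 < max C 1 := lt_max_of_lt_right one_pos
  refine ⟨β₀ / max C 1, div_pos hβ₀ hm, fun β hβ ε hε => ?_⟩
  have hβ' : |β| * max C 1 ≤ β₀ := by
    calc |β| * max C 1 ≤ β₀ / max C 1 * max C 1 := mul_le_mul_of_nonneg_right hβ hm.le
      _ = β₀ := div_mul_cancel₀ β₀ hm.ne'
  exact Hβ A b G hA hb hG (max C 1) hm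
    (fun s hs y => (hC s hs y).trans (mul_le_mul_of_nonneg_right (le_max_left _ _) (by positivity))) h0 h1 h2 β hβ' ε hε

end Summit.AtomisticToContinuum.HydrodynamicLimit.Theorems.HydroLimitInBandSignedBand

end
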